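import Literature.Analysis.FluidPDE.TaoCascadeRescaledBootstrap
import Mathlib.Analysis.SpecialFunctions.Sqrt
import HarnessLib

/-!
# Tao's cascade ODE, §6.7: the zero-scale quantities at the rescaled time `0`

T. Tao, *Finite time blowup for an averaged three-dimensional Navier–Stokes equation*,
J. Amer. Math. Soc. **29** (2016), 601–674 = arXiv:1402.0290v3, §6.7: the initial values entering
(6.146) ("from (6.54)–(6.58) and (6.66) we have `a₀(0)²+b₀(0)²+c₀(0)²+d₀(0)²+a₁(0)² = 1 + O(K^{-20})`"),
(6.147) ("from (6.55), (6.56) we have `(b₀(0)²+c₀(0)²)^{1/2} ≤ (10⁻⁵ + O(K⁻¹))ε`") and (6.150)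
("from (6.58), (6.66) we have `(d₀(0)²+a₁(0)²)^{1/2} = O(K^{-10})`"), computed from the hypotheses
(viii) of Prop. 6.5 (`RescaledHypotheses γ …`, `TaoCascadeRescaled.lean`; `γ` is the
`X₃`-coefficient of (6.56)) and Lemma 6.8 (`RescaledHypotheses.energy_one_zero_le` of
`TaoCascadeRescaledBootstrap.lean`), with explicit constants.

## References

* T. Tao, J. Amer. Math. Soc. 29 (2016), 601–674, arXiv:1402.0290v3, §6.4 (6.54)–(6.58), §6.7
  (6.146), (6.147), (6.150). [`Tao2016AveragedNS`]
-/

noncomputable section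

open Set

namespace Literature.Analysis.FluidPDE

namespace TaoCascade

section ZeroInit

variable {γ ε₀ K ε C₁ C₂ C₃ : ℝ} {n₀ N : ℤ} {τ : ℤ → ℝ} {Xr : Fin 4 → ℤ → ℝ → ℝ} {Er : ℤ → ℝ → ℝ}

/-- `a₁(0)² ≤ 2K^{-30}` (from (6.51) and Lemma 6.8 `Ẽ₁(0) ≤ K^{-30}`).
[cite: Tao2016AveragedNS, §6.7 (6.150)] -/
theorem RescaledHypotheses.a_one_zero_sq_le
    (h : RescaledHypotheses γ ε₀ K ε C₁ C₂ C₃ n₀ N τ Xr Er) (hε₀ : 0 < ε₀) (hK : 0 < K)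
    (hN : n₀ ≤ N) : Xr 0 1 0 ^ 2 ≤ 2 * (K ^ 30)⁻¹ := by
  have hτ0 : τ (n₀ - N) ≤ 0 := h.tau_le _ le_rfl (by omega)
  have := h.sq_le_two_mul_energy 0 1 hτ0 (t := 0)
  linarith [h.energy_one_zero_le hε₀ hK hN]

/-- **The conserved quantity at time `0`** ((6.146)): `S(0) = a₀(0)²+b₀(0)²+c₀(0)²+d₀(0)²+a₁(0)²`
satisfies `1 ≤ S(0) ≤ 1 + 10^{-10}ε² + γ²ε⁴ + K^{-20} + 2K^{-30}`.
[cite: Tao2016AveragedNS, §6.7 (6.146)] -/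
theorem RescaledHypotheses.zero_energy_init
    (h : RescaledHypotheses γ ε₀ K ε C₁ C₂ C₃ n₀ N τ Xr Er) (hε₀ : 0 < ε₀) (hK : 0 < K)
    (hN : n₀ ≤ N) :
    1 ≤ Xr 0 0 0 ^ 2 + Xr 1 0 0 ^ 2 + Xr 2 0 0 ^ 2 + Xr 3 0 0 ^ 2 + Xr 0 1 0 ^ 2 ∧
      Xr 0 0 0 ^ 2 + Xr 1 0 0 ^ 2 + Xr 2 0 0 ^ 2 + Xr 3 0 0 ^ 2 + Xr 0 1 0 ^ 2 ≤
        1 + (1 / 10 ^ 5 * ε) ^ 2 + (γ * ε ^ 2) ^ 2 + ((K ^ 10)⁻¹) ^ 2 + 2 * (K ^ 30)⁻¹ := by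
  have ha : Xr 0 0 0 ^ 2 = 1 := by rw [h.a_eq]; norm_num
  have hb : Xr 1 0 0 ^ 2 ≤ (1 / 10 ^ 5 * ε) ^ 2 := by
    rw [← sq_abs]; exact pow_le_pow_left₀ (abs_nonneg _) h.b_abs_le 2
  have hc : Xr 2 0 0 ^ 2 ≤ (γ * ε ^ 2) ^ 2 := by
    rw [← sq_abs]; exact pow_le_pow_left₀ (abs_nonneg _) h.c_abs_le 2
  have hd : Xr 3 0 0 ^ 2 ≤ ((K ^ 10)⁻¹) ^ 2 := by
    rw [← sq_abs]; exact pow_le_pow_left₀ (abs_nonneg _) h.d_abs_le 2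
  have h1 := h.a_one_zero_sq_le hε₀ hK hN
  constructor
  · nlinarith [sq_nonneg (Xr 1 0 0), sq_nonneg (Xr 2 0 0), sq_nonneg (Xr 3 0 0), sq_nonneg (Xr 0 1 0)]
  · linarith

/-- **`√(b₀(0)²+c₀(0)²) ≤ 10⁻⁵ε + γε²`** ((6.147), `γ ≥ 0`, `ε ≥ 0`).
[cite: Tao2016AveragedNS, §6.7 (6.147)] -/
theorem RescaledHypotheses.sqrt_bc_zero_le
    (h : RescaledHypotheses γ ε₀ K ε C₁ C₂ C₃ n₀ N τ Xr Er) (hγ : 0 ≤ γ) (hε : 0 ≤ ε) :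
    Real.sqrt (Xr 1 0 0 ^ 2 + Xr 2 0 0 ^ 2) ≤ 1 / 10 ^ 5 * ε + γ * ε ^ 2 := by
  have hb := h.b_abs_le
  have hc := h.c_abs_le
  have hB : 0 ≤ 1 / 10 ^ 5 * ε := by positivity
  have hC : 0 ≤ γ * ε ^ 2 := by positivity
  rw [Real.sqrt_le_left (by positivity)]
  nlinarith [sq_abs (Xr 1 0 0), sq_abs (Xr 2 0 0), abs_nonneg (Xr 1 0 0), abs_nonneg (Xr 2 0 0),
    mul_nonneg hB hC]

/-- **`√(d₀(0)²+a₁(0)²) ≤ K^{-10} + √2·K^{-15}`** ((6.150): "`(d₀(0)²+a₁(0)²)^{1/2} = O(K^{-10})`").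
[cite: Tao2016AveragedNS, §6.7 (6.150)] -/
theorem RescaledHypotheses.sqrt_da_zero_le
    (h : RescaledHypotheses γ ε₀ K ε C₁ C₂ C₃ n₀ N τ Xr Er) (hε₀ : 0 < ε₀) (hK : 0 < K)
    (hN : n₀ ≤ N) :
    Real.sqrt (Xr 3 0 0 ^ 2 + Xr 0 1 0 ^ 2) ≤ (K ^ 10)⁻¹ + Real.sqrt 2 * (K ^ 15)⁻¹ := by
  have hd := h.d_abs_le
  have h1 := h.a_one_zero_sq_le hε₀ hK hN
  have hD : 0 ≤ (K ^ 10)⁻¹ := by positivity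
  have hA : 0 ≤ Real.sqrt 2 * (K ^ 15)⁻¹ := by positivity
  have hsq2 : Real.sqrt 2 ^ 2 = 2 := Real.sq_sqrt (by norm_num)
  have hK15 : ((K ^ 15)⁻¹) ^ 2 = (K ^ 30)⁻¹ := by rw [inv_pow, ← pow_mul]
  have ha1 : Xr 0 1 0 ^ 2 ≤ (Real.sqrt 2 * (K ^ 15)⁻¹) ^ 2 := by
    rw [mul_pow, hsq2, hK15]; linarith
  rw [Real.sqrt_le_left (by positivity)]
  nlinarith [sq_abs (Xr 3 0 0), abs_nonneg (Xr 3 0 0), mul_nonneg hD hA]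

end ZeroInit

end TaoCascade

end Literature.Analysis.FluidPDE
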